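import Mathlib
import Literature.Combinatorics.Optimization.MaxCutSheraliAdamsGap
import Literature.Combinatorics.Optimization.VertexCoverGapGraphs
import HarnessLib

/-!
# The Charikar–Makarychev–Makarychev Sherali–Adams gap for VERTEX COVER (CMM09 Theorem 5.4), proved

[topic Combinatorics/Optimization]

[CharikarMakarychevMakarychev2009] §5, p. 10–12.  The relaxation (p. 10): "The base LP relaxation for
Vertex Cover is `min Σ_{i∈V} x_i` subject to: (i) `x_i + x_j ≥ 1` for every edge `(i, j)`; (ii)
`1 − x_i ≥ 0`; (iii) `x_i ≥ 0`.  For every set of vertices `I` of size at most `r + 1`, we introduce a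
variable `y_I`. We require that 1. `y_{i} = x_i`. 2. For every set of vertices `T` of size at most
`r + 3` there exists a distribution of vertex covers on `T` such that `y_I` equals the probability that
all vertices from `I` lie in the vertex cover.  Our second condition implies that the vector of `y_I`
lies in the lifted Sherali–Adams polytope (the proof is similar to the proof of Lemma 2.1)."  The value
of Vertex Cover is normalised (p. 8): "the value of Vertex Cover is `α ∈ [0, 1]`, if the vertex cover
contains an `α` fraction of all vertices."

> **Theorem 5.4.** For every `ε > 0` there exists `γ > 0` such that the integrality gap of the
> relaxation for Vertex Cover is `2 − ε` after `r = n^γ` rounds of the Sherali–Adams lift-and-project.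
>
> *Proof.* Consider a graph `G = (V, E)` with maximum degree `∆` such that (i) every vertex cover
> contains at least `1 − ε/6` fraction of all vertices; (2) every subgraph on `k` vertices is
> `Ω(log(n/k))`-path decomposable. Let `γ = cε²/(∆² c_∆)` … `r = n^γ`, `k = (∆ + 1)(r + 2)` … For every
> set `T` of at most `r + 2` vertices, let us define a distribution of vertex covers `D_T` on `T` as
> follows. Denote the set of vertices in `T` and their neighbors by `N(T)`. Note that `N(T)` contains at
> most `k = (∆ + 1)(r + 2)` vertices. By Theorem 5.2, there exists an embedding `ψ` of `N(T)` in the unit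
> sphere … Choose a random hyperplane passing through the origin. Choose randomly one of the two
> half-spaces. Denote it by `H`. Now we define the vertex cover `VC`. Let a vertex `u` be in the vertex
> cover `VC` if either `ψ(u) ∈ H` or there exists a neighbor `v` of `u` such that `ψ(v) ∉ H`.  Note that
> `VC` is a vertex cover of `T` … Now consider two distributions `D_{T₁}` and `D_{T₂}`. We claim that
> they agree on `T₁ ∩ T₂` … (we choose the same half-space `H` when we construct both vertex covers).
> … Let us estimate the value of `x_i`. Vertex `i` belongs to the vertex cover if either `ψ(i) ∈ H`, or
> one of the edges incident to `i` is not cut by the random hyperplane. The former event happens with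
> probability `1/2`. The latter event happens with probability at most `∆` times the probability that
> one edge is not cut … `≤ 1/2 + ∆·O(√µ) ≤ 1/2 + ε/6`.  Therefore, the value of the solution `x` is at
> most `(1/2 + ε/6)|V|`. The value of the optimal combinatorial solution is at least `(1 − ε/6)|V|`.
> Hence the integrality gap is at least `2 − ε`.

This file PROVES Theorem 5.4 on top of the formalisation of Theorem 5.3 (MAX-CUT) in this directory
(`SheraliAdamsLocalDistributions`, `GaussianSignRounding`, `SheraliAdamsGapFromLocalKernels`,
`MulticutCorrelations`, `PathDecomposableMulticuts`, `MaxCutSheraliAdamsGap`) and the vertex-cover clause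
of the gap graphs (`VertexCoverGapGraphs`):

* **The relaxation, local form** (`VCLocalSolution n d E`): consistent local distributions on all vertex
  sets of size `≤ d` (`LocalExpectations n d`, the tree's Lemma 2.1 currency) each supported on the
  vertex covers of the induced subgraph (`cover`); its LP point `x_i = Pr_{D_{{i}}}[i ∈ VC]` (`x`) and
  objective `Σ_i x_i` (`value`).  Bridge to the Kothari–Meka–Raghavendra pseudoexpectation currency of
  the tree: `Ẽ = toSA` satisfies `Ẽ[x_i] = x_i` (`saE_coord`) and the Sherali–Adams constraints of the
  Vertex Cover LP, `Ẽ[(x_u + x_v − 1)·q] ≥ 0` for every edge `uv` and every nonnegative junta `q` on `S`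
  with `|S ∪ {u,v}| ≤ d` (`saE_edge_mul_nonneg`) — "the vector of `y_I` lies in the lifted
  Sherali–Adams polytope".
* **The local vertex covers** (`GaussianSignRounding.vcOfSigns`, `vcL`, `vcLocalSolution`): for a kernel
  `K` whose minors on the closed neighbourhoods `N[T] = B(T,1)` (`Multicut.ball E T 1`) of the sets
  `|T| ≤ d` are positive semidefinite, the Gaussian sign rounding on `N[T]` (Thm 3.1, Gram form) pushed
  forward along `σ ↦ VC(σ) = {u : σ_u = + ∨ ∃ v ∼ u, σ_v = −}`; consistency on `Q ⊆ T` because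
  membership of `u` depends on the signs on `N[u] ⊆ N[Q] ⊆ N[T]` only and the rounding marginalises
  (`L_restrict`); `VC(σ)` covers every edge inside `T`.
* **The value** (`measure_nonneg_toReal`, `vcL_coord_le`, `value_vcLocalSolution_le`):
  `Pr[ψ(i) ∈ H] = 1/2` exactly (the centred Gaussian marginal is symmetric and atomless), and
  `Pr[i ∈ VC] ≤ 1/2 + Σ_{v∼i} Pr[i, v on the same side] ≤ 1/2 + ∆ε` when `K_iv ≤ −1 + ε³/16` on edges
  (`measure_sameSide_le`, replacing the printed `∆·O(√µ)`, as in the MAX-CUT file).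
* **Assembly** (`exists_vcLocalSolution_of_localCorrelations`, `_of_gapGraph`,
  **`CharikarMakarychevMakarychev2009_thm54`**, `CharikarMakarychevMakarychev2009_thm54_gap`): the corrected
  kernel `cmmKernel (cmmTarget E µ L) µ` of Thm 5.2 is positive semidefinite on all sets of size
  `≤ (∆+1)d` (`cmm_hloc` + `posSemidef_localCov_cmmKernel`), and the parameters are those of
  `maxCutSA_of_gapGraphs` with `d` replaced by `(∆+1)d`: `ε₁ = min(ε,1)/(∆+1)`, `µ = ε₁³/40`,
  `c' = min(c, 1/(4 log(∆+2)))`, `L = ⌊c' log n⌋/9`, `γ = µc'/18`, `d = ⌊n^γ⌋`.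

RECORDED RENDERING DECISIONS (none changes the content of Theorem 5.4).  (1) As in the whole CMM series
of this directory, the Sherali–Adams level is the SET SIZE `d` of the local distributions (CMM: `r`
rounds ↔ sets `T` of size `≤ r + 3` on p. 10, `≤ r + 2` on p. 12); the theorem is stated for level
`⌊n^γ⌋`, which absorbs the `+3`.  (2) The two sides are typed with one `ε`: every vertex cover has MORE
than `(1 − ε)n` vertices and the relaxation has a solution of value `≤ (1/2 + ε)n`; the printed ratio
form "integrality gap at least `2 − ε`" is the corollary `_thm54_gap` (`ε ↦ ε/6`).  (3) `N(T)` is the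
radius-`1` ball `B(T, 1)`; "choose randomly one of the two half-spaces" is absorbed by the symmetry of
the centred Gaussian (the sign-pattern law is already symmetric).  (4) The value estimate uses the
elementary separation bound of `GaussianSignRounding` instead of `arccos`, exactly as for Theorem 5.3.

Everything is proved; no named facts; no `sorry`.

## References

* [CharikarMakarychevMakarychev2009] M. Charikar, K. Makarychev, Y. Makarychev, *Integrality gaps for
  Sherali–Adams relaxations*, STOC 2009, 283–292, doi:10.1145/1536414.1536455; §5 p. 8 (normalisation),
  p. 10 (the Vertex Cover relaxation, the random graphs), Thm 5.4 and its proof (p. 11–12), Thm 5.2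
  (p. 9–10), Thm 3.1 (p. 6), Lemma 2.1 (p. 4–5).  Held text `paper:doi-10-1145-1536414-1536455`.
* [AroraBollobasLovaszTourlakis2006] S. Arora, B. Bollobás, L. Lovász, I. Tourlakis, *Proving
  integrality gaps without knowing the linear program*, Theory of Computing 2 (2006), Lemma 2.8, 2.12
  (the graphs; earlier Vertex Cover LP gaps).
* [KothariMekaRaghavendra2017] P. Kothari, R. Meka, P. Raghavendra, STOC 2017 / SICOMP 2022, Def. 3.3
  (the pseudoexpectation currency of `toSA`).
-/

noncomputable section

open Finset Matrix MeasureTheory ProbabilityTheory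

namespace Literature.Combinatorics.Optimization

variable {n : ℕ}

/-! ### Vertex covers of an edge set -/

/-- `C` is a vertex cover of the edge set `E`: every edge has an endpoint in `C`.
[cite: CharikarMakarychevMakarychev2009, §5 (p. 8: "the value of Vertex Cover is α … if the vertex cover contains an α fraction of all vertices")] -/
def IsVertexCoverOf (E : Finset (Sym2 (Fin n))) (C : Finset (Fin n)) : Prop :=
  ∀ e ∈ E, ∃ v ∈ e, v ∈ C

/-- **"Every vertex cover contains at least `1 − ε` fraction of all vertices"** from the independent-set
form of the gap graphs: if every vertex set of size `≥ εn` spans an edge, every vertex cover has more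
than `(1 − ε)n` vertices (its complement is independent).
[cite: CharikarMakarychevMakarychev2009, §5 (p. 10) and proof of Thm 5.4 (p. 12: "the optimal combinatorial solution is at least (1 − ε/6)|V|")] -/
theorem card_vertexCover_gt {E : Finset (Sym2 (Fin n))} {ε : ℝ}
    (hE : ∀ S : Finset (Fin n), ε * n ≤ S.card → ∃ e ∈ E, ∀ v ∈ e, v ∈ S)
    {C : Finset (Fin n)} (hC : IsVertexCoverOf E C) : (1 - ε) * n < C.card := by
  classical
  set S : Finset (Fin n) := univ \ C with hS
  have hCn : C.card ≤ n := by simpa using card_le_univ C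
  have hScard : (S.card : ℝ) = n - C.card := by
    rw [hS, card_sdiff_of_subset (subset_univ _), card_univ, Fintype.card_fin, Nat.cast_sub hCn]
  by_contra hle
  push Not at hle
  have hSε : ε * n ≤ S.card := by rw [hScard]; linarith
  obtain ⟨e, he, hsub⟩ := hE S hSε
  obtain ⟨v, hv, hvC⟩ := hC e he
  have := hsub v hv
  rw [hS, mem_sdiff] at this
  exact this.2 hvC

/-! ### The lifted relaxation of VERTEX COVER in local form -/

/-- **The level-`d` Sherali–Adams relaxation of VERTEX COVER on the graph `E`, local form** (CMM p. 10,
condition 2): consistent local distributions `D_T` on `{0,1}^T` for all vertex sets `T` with `|T| ≤ d`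
(the tree's `LocalExpectations n d`, CMM Lemma 2.1), each SUPPORTED ON VERTEX COVERS of the induced
subgraph: for every edge `uv ⊆ T`, `Pr_{D_T}[x_u = x_v = 0] = 0`.
[cite: CharikarMakarychevMakarychev2009, §5 (p. 10: "For every set of vertices T of size at most r + 3 there exists a distribution of vertex covers on T such that y_I equals the probability that all vertices from I lie in the vertex cover")] -/
structure VCLocalSolution (n d : ℕ) (E : Finset (Sym2 (Fin n))) extends LocalExpectations n d where
  /-- `D_T` is supported on vertex covers of the subgraph induced on `T` -/
  cover : ∀ T : Finset (Fin n), T.card ≤ d → ∀ u v : ↥T, s((u : Fin n), (v : Fin n)) ∈ E →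
    L T (fun b => if b u = false ∧ b v = false then (1 : ℝ) else 0) = 0

namespace VCLocalSolution

variable {d : ℕ} {E : Finset (Sym2 (Fin n))} (Λ : VCLocalSolution n d E)

/-- The LP point: `x_i = y_{{i}} = Pr_{D_{{i}}}[i ∈ VC]`.
[cite: CharikarMakarychevMakarychev2009, §5 (p. 10: "y_{i} = x_i") and (p. 12: "Let x_i = y_{i}")] -/
def x (i : Fin n) : ℝ := Λ.L {i} (fun b => if b ⟨i, mem_singleton_self i⟩ then 1 else 0)

/-- The objective `Σ_i x_i` of the Vertex Cover LP (the printed value is this divided by `|V| = n`).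
[cite: CharikarMakarychevMakarychev2009, §5 (p. 10: "min Σ_{i∈V} x_i") and (p. 8: normalisation)] -/
def value : ℝ := ∑ i, Λ.x i

/-- `0 ≤ x_i` (constraint (iii)). [cite: CharikarMakarychevMakarychev2009, §5 (p. 10, constraint (iii))] -/
theorem x_nonneg (hd : 1 ≤ d) (i : Fin n) : 0 ≤ Λ.x i :=
  Λ.nonneg {i} (by simpa using hd) _ fun b => by split_ifs <;> norm_num

/-- `x_i ≤ 1` (constraint (ii)). [cite: CharikarMakarychevMakarychev2009, §5 (p. 10, constraint (ii))] -/
theorem x_le_one (hd : 1 ≤ d) (i : Fin n) : Λ.x i ≤ 1 :=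
  Λ.le_one (by simpa using hd) fun b => by split_ifs <;> norm_num

/-- `0 ≤ value`. [cite: CharikarMakarychevMakarychev2009, §5 (p. 10)] -/
theorem value_nonneg (hd : 1 ≤ d) : 0 ≤ Λ.value := sum_nonneg fun i _ => Λ.x_nonneg hd i

/-- **Bridge to the pseudoexpectation currency, I**: `Ẽ[x_i] = x_i` for the degree-`d` Sherali–Adams
pseudoexpectation `Ẽ = Λ.toSA` of the family (CMM Lemma 2.1 in KMR form, `LocalExpectations.toSA`).
[cite: CharikarMakarychevMakarychev2009, Lemma 2.1 (p. 4–5) and §5 (p. 10: "y_{i} = x_i")] -/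
theorem saE_coord (hd : 1 ≤ d) (i : Fin n) :
    Λ.saE (fun x => if x i then 1 else 0) = Λ.x i := by
  rw [Λ.saE_eq_of_dependsOn (T := {i}) (by simpa using hd)
    (fun x y h => by rw [h i (mem_singleton_self i)])]
  unfold VCLocalSolution.x
  congr 1
  funext b
  simp [LocalExpectations.extend]

/-- **Bridge to the pseudoexpectation currency, II — the lifted constraints of the Vertex Cover LP**:
for every edge `uv` of `E` and every nonnegative junta `q` on `S` with `|S ∪ {u,v}| ≤ d`,
`Ẽ[(x_u + x_v − 1)·q] ≥ 0` ("the vector of `y_I` lies in the lifted Sherali–Adams polytope": the local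
distribution on `S ∪ {u,v}` is supported on vertex covers, on which `x_u + x_v − 1 ≥ 0`).
[cite: CharikarMakarychevMakarychev2009, §5 (p. 10: constraint (i) and "Our second condition implies that the vector of y_I lies in the lifted Sherali–Adams polytope")] -/
theorem saE_edge_mul_nonneg {u v : Fin n} (huv : s(u, v) ∈ E) {S : Finset (Fin n)}
    {q : (Fin n → Bool) → ℝ} (hq : ∀ x y : Fin n → Bool, (∀ i ∈ S, x i = y i) → q x = q y)
    (hq0 : ∀ x, 0 ≤ q x) (hcard : (S ∪ {u, v}).card ≤ d) :
    0 ≤ Λ.saE (fun x => ((if x u then (1 : ℝ) else 0) + (if x v then 1 else 0) - 1) * q x) := by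
  classical
  set T : Finset (Fin n) := S ∪ {u, v} with hT
  have hu : u ∈ T := by simp [hT]
  have hv : v ∈ T := by simp [hT]
  set g : (Fin n → Bool) → ℝ :=
    fun x => ((if x u then (1 : ℝ) else 0) + (if x v then 1 else 0) - 1) * q x with hg
  have hdep : ∀ x y : Fin n → Bool, (∀ i ∈ T, x i = y i) → g x = g y := by
    intro x y h
    simp only [hg]
    rw [h u hu, h v hv, hq x y fun i hi => h i (by simp [hT, hi])]
  rw [Λ.saE_eq_of_dependsOn hcard hdep]
  -- the integrand is `≥ −M·𝟙[x_u = x_v = 0]`, and the bad event has probability `0`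
  set G : (↥T → Bool) → ℝ := fun b => g (LocalExpectations.extend T b) with hG
  set M : ℝ := ∑ b, |G b| with hM
  have hMb : ∀ b, |G b| ≤ M := fun b =>
    single_le_sum (f := fun b => |G b|) (fun _ _ => abs_nonneg _) (mem_univ b)
  have hcov := Λ.cover T hcard ⟨u, hu⟩ ⟨v, hv⟩ huv
  have hlow : ∀ b : ↥T → Bool,
      -M * (if b ⟨u, hu⟩ = false ∧ b ⟨v, hv⟩ = false then (1 : ℝ) else 0) ≤ G b := by
    intro b
    by_cases hb : b ⟨u, hu⟩ = false ∧ b ⟨v, hv⟩ = false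
    · rw [if_pos hb, mul_one]
      linarith [neg_abs_le (G b), hMb b]
    · rw [if_neg hb, mul_zero]
      -- not both zero: `x_u + x_v − 1 ≥ 0`
      have hu' : LocalExpectations.extend T b u = b ⟨u, hu⟩ := by
        simp [LocalExpectations.extend, hu]
      have hv' : LocalExpectations.extend T b v = b ⟨v, hv⟩ := by
        simp [LocalExpectations.extend, hv]
      change 0 ≤ ((if LocalExpectations.extend T b u then (1 : ℝ) else 0) +
        (if LocalExpectations.extend T b v then 1 else 0) - 1) * q (LocalExpectations.extend T b)
      rw [hu', hv']
      refine mul_nonneg ?_ (hq0 _)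
      rw [not_and_or] at hb
      rcases hb with h | h
      · rw [Bool.not_eq_false] at h
        rw [if_pos h]; split_ifs <;> norm_num
      · rw [Bool.not_eq_false] at h
        rw [if_pos h]; split_ifs <;> norm_num
  have hmono := Λ.mono hcard hlow
  have hlin : Λ.L T (fun b => -M * (if b ⟨u, hu⟩ = false ∧ b ⟨v, hv⟩ = false then (1 : ℝ) else 0)) =
      -M * Λ.L T (fun b => if b ⟨u, hu⟩ = false ∧ b ⟨v, hv⟩ = false then (1 : ℝ) else 0) := by
    have := map_smul (Λ.L T) (-M)
      (fun b : ↥T → Bool => if b ⟨u, hu⟩ = false ∧ b ⟨v, hv⟩ = false then (1 : ℝ) else 0)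
    simpa only [smul_eq_mul, Pi.smul_def] using this
  rw [hlin, hcov, mul_zero] at hmono
  exact hmono

end VCLocalSolution

/-! ### The local vertex covers of Theorem 5.4 from Gaussian sign rounding -/

namespace GaussianSignRounding

variable (K : Matrix (Fin n) (Fin n) ℝ) (E : Finset (Sym2 (Fin n)))

/-- The closed neighbourhood `N(T)` of `T` ("the set of vertices in `T` and their neighbors"): the ball
of radius `1`. [cite: CharikarMakarychevMakarychev2009, Thm 5.4 proof (p. 12: "Denote the set of vertices in T and their neighbors by N(T)")] -/
abbrev nbhd (T : Finset (Fin n)) : Finset (Fin n) := Multicut.ball E T 1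

/-- `T ⊆ N(T)`. [cite: CharikarMakarychevMakarychev2009, Thm 5.4 proof (p. 12)] -/
theorem subset_nbhd (T : Finset (Fin n)) : T ⊆ nbhd E T := fun _ ht => Multicut.mem_ball_of_mem ht

/-- Neighbours of points of `T` are in `N(T)`. [cite: CharikarMakarychevMakarychev2009, Thm 5.4 proof (p. 12)] -/
theorem mem_nbhd_of_edge {T : Finset (Fin n)} {u v : Fin n} (hu : u ∈ T) (huv : s(u, v) ∈ E) :
    v ∈ nbhd E T := by
  by_cases h : u = v
  · subst h; exact subset_nbhd E T hu
  · simp only [nbhd, Multicut.ball, Finset.mem_filter, Finset.mem_univ, true_and]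
    refine ⟨u, hu, ?_⟩
    have hadj : (Multicut.gr E).Adj u v := Multicut.gr_adj.2 ⟨huv, h⟩
    rw [SimpleGraph.edist_eq_one_iff_adj.2 hadj]
    simp

/-- `N(·)` is monotone. [cite: CharikarMakarychevMakarychev2009, Thm 5.4 proof (p. 12)] -/
theorem nbhd_mono {Q T : Finset (Fin n)} (h : Q ⊆ T) : nbhd E Q ⊆ nbhd E T := by
  intro v hv
  simp only [nbhd, Multicut.ball, Finset.mem_filter, Finset.mem_univ, true_and] at hv ⊢
  obtain ⟨t, ht, hd⟩ := hv
  exact ⟨t, h ht, hd⟩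

/-- `|N(T)| ≤ (∆+1)|T|` under maximum degree `∆`. [cite: CharikarMakarychevMakarychev2009, Thm 5.4 proof (p. 12: "N(T) contains at most k = (∆ + 1)(r + 2) vertices")] -/
theorem card_nbhd_le {Δ : ℕ} (hΔ : ∀ v : Fin n, (E.filter fun e => v ∈ e).card ≤ Δ)
    (T : Finset (Fin n)) : (nbhd E T).card ≤ T.card * (Δ + 1) := by
  simpa using Multicut.card_ball_le E hΔ T 1

/-- **The vertex cover read off a sign pattern on `N(T)`**: `u ∈ VC` iff `ψ(u) ∈ H` (sign `+`, i.e.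
`z_u ≥ 0`) or some neighbour `v` of `u` has `ψ(v) ∉ H` (sign `−`).
[cite: CharikarMakarychevMakarychev2009, Thm 5.4 proof (p. 12: "Let a vertex u be in the vertex cover VC if either ψ(u) ∈ H or there exists a neighbor v of u such that ψ(v) ∉ H")] -/
def vcOfSigns (T : Finset (Fin n)) (b : ↥(nbhd E T) → Bool) : ↥T → Bool := fun u =>
  b ⟨u.1, subset_nbhd E T u.2⟩ ||
    decide (∃ v : ↥(nbhd E T), s(u.1, v.1) ∈ E ∧ b v = false)

/-- **`VC` is a vertex cover of `T`**: if `u ∉ VC` then `ψ(u) ∉ H`, hence every neighbour `v ∈ T` of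
`u` is in `VC`. [cite: CharikarMakarychevMakarychev2009, Thm 5.4 proof (p. 12: "Note that VC is a vertex cover of T")] -/
theorem vcOfSigns_cover {T : Finset (Fin n)} (b : ↥(nbhd E T) → Bool) {u v : ↥T}
    (huv : s((u : Fin n), (v : Fin n)) ∈ E) :
    ¬ (vcOfSigns E T b u = false ∧ vcOfSigns E T b v = false) := by
  rintro ⟨hu, hv⟩
  simp only [vcOfSigns, Bool.or_eq_false_iff, decide_eq_false_iff_not, not_exists, not_and] at hu hv
  exact hu.2 ⟨v.1, subset_nbhd E T v.2⟩ huv hv.1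

/-- **Locality of `VC`**: for `Q ⊆ T`, the vertex cover of `Q` read off the restriction to `N(Q)` of a
sign pattern on `N(T)` is the restriction to `Q` of the vertex cover of `T` (membership of `u` depends
on the signs on `u` and its neighbours only).
[cite: CharikarMakarychevMakarychev2009, Thm 5.4 proof (p. 12: "u ∈ T₁ ∩ T₂ belongs to the vertex cover chosen according to D_{T₁} if and only if it belongs to the vertex cover chosen according to D_{T₂}")] -/
theorem restrict_vcOfSigns {Q T : Finset (Fin n)} (h : Q ⊆ T) (b : ↥(nbhd E T) → Bool) :
    Finset.restrict₂ (π := fun _ => Bool) h (vcOfSigns E T b) =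
      vcOfSigns E Q (Finset.restrict₂ (π := fun _ => Bool) (nbhd_mono E h) b) := by
  funext u
  change vcOfSigns E T b ⟨u.1, h u.2⟩ =
    vcOfSigns E Q (fun v => b ⟨v.1, nbhd_mono E h v.2⟩) u
  rw [Bool.eq_iff_iff]
  simp only [vcOfSigns, Bool.or_eq_true, decide_eq_true_eq]
  constructor
  · rintro (hb | ⟨v, hv, hbv⟩)
    · exact Or.inl hb
    · exact Or.inr ⟨⟨v.1, mem_nbhd_of_edge E u.2 hv⟩, hv, hbv⟩
  · rintro (hb | ⟨v, hv, hbv⟩)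
    · exact Or.inl hb
    · exact Or.inr ⟨⟨v.1, nbhd_mono E h v.2⟩, hv, hbv⟩

/-- **The local distribution of vertex covers `D_T`**, as its expectation functional: the Gaussian sign
rounding of `K` on `N(T)` pushed forward along `σ ↦ VC(σ)`.
[cite: CharikarMakarychevMakarychev2009, Thm 5.4 proof (p. 12: "let us define a distribution of vertex covers D_T on T as follows")] -/
def vcL (T : Finset (Fin n)) : ((↥T → Bool) → ℝ) →ₗ[ℝ] ℝ where
  toFun F := L K (nbhd E T) (fun b => F (vcOfSigns E T b))
  map_add' F G := by
    change L K (nbhd E T) ((fun b => F (vcOfSigns E T b)) + fun b => G (vcOfSigns E T b)) = _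
    rw [map_add]
  map_smul' a F := by
    change L K (nbhd E T) (a • fun b => F (vcOfSigns E T b)) = _
    rw [map_smul]; rfl

/-- Unfolding `vcL`. [cite: CharikarMakarychevMakarychev2009, Thm 5.4 proof (p. 12)] -/
theorem vcL_apply (T : Finset (Fin n)) (F : (↥T → Bool) → ℝ) :
    vcL K E T F = L K (nbhd E T) (fun b => F (vcOfSigns E T b)) := rfl

/-- **Consistency of the `D_T`** ("`D_{T₁}` and `D_{T₂}` agree on `T₁ ∩ T₂`"): for `Q ⊆ T` with
`K|_{N(T)} ⪰ 0`, the push-forward of `D_T` to `{0,1}^Q` is `D_Q` — locality of `VC` plus Gaussian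
marginalisation `N(0, K|_{N(T)}) → N(0, K|_{N(Q)})`.
[cite: CharikarMakarychevMakarychev2009, Thm 5.4 proof (p. 12) with Thm 3.1 (p. 6)] -/
theorem vcL_restrict {Q T : Finset (Fin n)} (h : Q ⊆ T) (hT : (localCov K (nbhd E T)).PosSemidef)
    (F : (↥Q → Bool) → ℝ) :
    vcL K E T (fun b => F (Finset.restrict₂ (π := fun _ => Bool) h b)) = vcL K E Q F := by
  rw [vcL_apply, vcL_apply]
  simp_rw [restrict_vcOfSigns E h]
  exact L_restrict K (nbhd_mono E h) hT (fun b' => F (vcOfSigns E Q b'))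

/-- **The Sherali–Adams solution of Theorem 5.4**: for a kernel whose minors on the closed
neighbourhoods of the sets of size `≤ d` are positive semidefinite, the local vertex-cover distributions
form a level-`d` solution of the Vertex Cover relaxation (consistent, supported on vertex covers).
[cite: CharikarMakarychevMakarychev2009, Thm 5.4 proof (p. 12: "the vector of x_i is a feasible solution of our relaxation")] -/
def vcLocalSolution (d : ℕ)
    (hK : ∀ T : Finset (Fin n), T.card ≤ d → (localCov K (nbhd E T)).PosSemidef) :
    VCLocalSolution n d E where
  L T := vcL K E T
  nonneg T _ F hF := L_nonneg K _ _ fun b => hF _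
  map_one T _ := L_one K _
  consistent _ _ h hT F := vcL_restrict K E h (hK _ hT) F
  cover T _ u v huv := by
    change L K (nbhd E T) (fun b =>
      if vcOfSigns E T b u = false ∧ vcOfSigns E T b v = false then (1 : ℝ) else 0) = 0
    have : (fun b : ↥(nbhd E T) → Bool =>
        if vcOfSigns E T b u = false ∧ vcOfSigns E T b v = false then (1 : ℝ) else 0) = fun _ => 0 := by
      funext b
      rw [if_neg (vcOfSigns_cover E b huv)]
    rw [this]
    exact map_zero _

/-- The local functionals of `vcLocalSolution`. [cite: CharikarMakarychevMakarychev2009, Thm 5.4 proof (p. 12)] -/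
@[simp] theorem vcLocalSolution_L (d : ℕ)
    (hK : ∀ T : Finset (Fin n), T.card ≤ d → (localCov K (nbhd E T)).PosSemidef) (T : Finset (Fin n)) :
    (vcLocalSolution K E d hK).L T = vcL K E T := rfl

/-! ### `Pr[ψ(i) ∈ H] = 1/2` and the value of the solution -/

/-- A centred real Gaussian puts mass exactly `1/2` on `[0, ∞)` (symmetry `x ↦ −x` and no atom at `0`).
[cite: CharikarMakarychevMakarychev2009, Thm 5.4 proof (p. 12: "The former event happens with probability 1/2")] -/
theorem gaussianReal_Ici_zero_toReal {v : NNReal} (hv : v ≠ 0) :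
    ((gaussianReal 0 v) (Set.Ici 0)).toReal = 1 / 2 := by
  set γ := gaussianReal 0 v with hγ
  -- symmetry: `γ(Iic 0) = γ(Ici 0)`
  have hsymm : γ (Set.Iic 0) = γ (Set.Ici 0) := by
    have hmap : γ.map (fun x : ℝ => -x) = γ := by
      rw [hγ, gaussianReal_map_neg, neg_zero]
    conv_lhs => rw [← hmap]
    rw [Measure.map_apply (by fun_prop) measurableSet_Iic]
    congr 1
    ext x; simp
  -- no atom at `0`
  have h0 : γ {0} = 0 := (gaussianReal_absolutelyContinuous 0 hv) (by simp)
  -- `γ(Ici 0) + γ(Iic 0) = γ(univ) + γ({0}) = 1`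
  have hsum : γ (Set.Ici 0) + γ (Set.Iic 0) = 1 := by
    have := measure_union_add_inter (μ := γ) (Set.Ici (0 : ℝ)) (measurableSet_Iic (a := (0 : ℝ)))
    rw [Set.Ici_inter_Iic, Set.Icc_self, h0, add_zero, Set.union_comm, Set.Iic_union_Ici,
      measure_univ] at this
    exact this.symm
  rw [hsymm] at hsum
  have hfin : γ (Set.Ici 0) ≠ ⊤ := measure_ne_top _ _
  have hreal : (γ (Set.Ici 0)).toReal + (γ (Set.Ici 0)).toReal = 1 := by
    rw [← ENNReal.toReal_add hfin hfin, hsum]; simp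
  linarith

variable {K}

/-- **`Pr[ψ(u) ∈ H] = 1/2`**: under `N(0, K|_T)` with `K_uu = 1`, the coordinate `z_u` is a standard
Gaussian, so `Pr[z_u ≥ 0] = 1/2`. [cite: CharikarMakarychevMakarychev2009, Thm 5.4 proof (p. 12: "The former event happens with probability 1/2")] -/
theorem measure_nonneg_toReal {T : Finset (Fin n)} (hT : (localCov K T).PosSemidef) (u : ↥T)
    (huu : K u u = 1) : ((gauss K T) {z | 0 ≤ z u}).toReal = 1 / 2 := by
  have hmp := measurePreserving_eval_multivariateGaussian (μ := (0 : EuclideanSpace ℝ ↥T)) hT (i := u)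
  have h1 : ((localCov K T) u u).toNNReal = 1 := by simp [huu]
  rw [h1] at hmp
  have hset : {z : EuclideanSpace ℝ ↥T | 0 ≤ z u} =
      (fun z : EuclideanSpace ℝ ↥T => z u) ⁻¹' Set.Ici 0 := by
    ext z; simp
  rw [gauss, hset, hmp.measure_preimage measurableSet_Ici.nullMeasurableSet]
  simp only [PiLp.zero_apply]
  exact gaussianReal_Ici_zero_toReal one_ne_zero

/-- **The value of a vertex** ("Vertex `i` belongs to the vertex cover if either `ψ(i) ∈ H`, or one of
the edges incident to `i` is not cut … `≤ 1/2 + ∆·O(√µ)`"): if `K ≡ 1` on the diagonal,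
`K_iv ≤ −1 + δ` on the edges at `i` with `δ ≤ ε³/16`, `i` lies on at most `∆` edges, and
`K|_{N({i})} ⪰ 0`, then `Pr_{D_{{i}}}[i ∈ VC] ≤ 1/2 + ∆ε`.
[cite: CharikarMakarychevMakarychev2009, Thm 5.4 proof (p. 12, the estimate of x_i)] -/
theorem vcL_coord_le {i : Fin n}
    (hT : (localCov K (nbhd E {i})).PosSemidef) (hdiag : ∀ u, K u u = 1) {δ ε : ℝ} (hε : 0 < ε)
    (hδ : δ ≤ ε ^ 3 / 16) (hedge : ∀ v : Fin n, s(i, v) ∈ E → K i v ≤ -1 + δ) {Δ : ℕ}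
    (hΔ : (E.filter fun e => i ∈ e).card ≤ Δ) :
    vcL K E {i} (fun b => if b ⟨i, mem_singleton_self i⟩ then 1 else 0) ≤ 1 / 2 + Δ * ε := by
  classical
  set N : Finset (Fin n) := nbhd E {i} with hN
  have hiN : i ∈ N := subset_nbhd E {i} (mem_singleton_self i)
  set i' : ↥N := ⟨i, hiN⟩ with hi'
  -- the neighbours of `i` inside `N`, and their number
  set nb : Finset ↥N := univ.filter fun v : ↥N => s(i, v.1) ∈ E with hnb
  have hnbcard : nb.card ≤ Δ := by
    refine le_trans ?_ hΔ
    refine Finset.card_le_card_of_injOn (fun v : ↥N => s(i, v.1)) (fun v hv => ?_) (fun v _ v' _ h => ?_)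
    · exact mem_coe.2 (mem_filter.2 ⟨(mem_filter.1 hv).2, Sym2.mem_mk_left _ _⟩)
    · exact Subtype.ext ((Sym2.congr_right (a := i)).1 h)
  -- the functional as a Gaussian measure
  rw [vcL_apply]
  have hind : (fun b : ↥N → Bool => if vcOfSigns E {i} b ⟨i, mem_singleton_self i⟩ then (1 : ℝ) else 0) =
      fun b => if b ∈ univ.filter (fun b : ↥N → Bool =>
        vcOfSigns E {i} b ⟨i, mem_singleton_self i⟩ = true) then 1 else 0 := by
    funext b; simp only [mem_filter, mem_univ, true_and]
  rw [hind, L_indicator]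
  -- the event is covered by `{z_i ≥ 0} ∪ ⋃_{v ∼ i} sameSide i v`
  have hcover : signPattern ⁻¹' ((univ.filter fun b : ↥N → Bool =>
        vcOfSigns E {i} b ⟨i, mem_singleton_self i⟩ = true : Finset (↥N → Bool)) : Set (↥N → Bool)) ⊆
      {z : EuclideanSpace ℝ ↥N | 0 ≤ z i'} ∪ ⋃ v ∈ nb, sameSide i' v := by
    intro z hz
    simp only [Set.mem_preimage, mem_coe, mem_filter, mem_univ, true_and] at hz
    simp only [vcOfSigns, Bool.or_eq_true, decide_eq_true_eq] at hz
    by_cases hzi : 0 ≤ z i'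
    · exact Set.mem_union_left _ hzi
    · refine Set.mem_union_right _ ?_
      rcases hz with h | ⟨v, hv, hbv⟩
      · exact absurd (by simpa [signPattern] using h) hzi
      · have hsame : z ∈ sameSide i' v := by
          simp only [sameSide, Set.mem_setOf_eq]
          simp only [signPattern, decide_eq_false_iff_not] at hbv
          rw [decide_eq_false (show ¬ 0 ≤ z i' from hzi), decide_eq_false hbv]
        exact Set.mem_iUnion₂.2 ⟨v, mem_filter.2 ⟨mem_univ _, hv⟩, hsame⟩
  have hfin : ∀ s : Set (EuclideanSpace ℝ ↥N), (gauss K N) s ≠ ⊤ := fun s => measure_ne_top _ _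
  calc ((gauss K N) (signPattern ⁻¹' ((univ.filter fun b : ↥N → Bool =>
          vcOfSigns E {i} b ⟨i, mem_singleton_self i⟩ = true : Finset (↥N → Bool)) :
            Set (↥N → Bool)))).toReal
      ≤ ((gauss K N) ({z : EuclideanSpace ℝ ↥N | 0 ≤ z i'} ∪ ⋃ v ∈ nb, sameSide i' v)).toReal :=
        ENNReal.toReal_mono (hfin _) (measure_mono hcover)
    _ ≤ ((gauss K N) {z : EuclideanSpace ℝ ↥N | 0 ≤ z i'}).toReal +
          ((gauss K N) (⋃ v ∈ nb, sameSide i' v)).toReal := by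
        rw [← ENNReal.toReal_add (hfin _) (hfin _)]
        exact ENNReal.toReal_mono (by simp [measure_ne_top]) (measure_union_le _ _)
    _ ≤ 1 / 2 + ∑ v ∈ nb, ((gauss K N) (sameSide i' v)).toReal := by
        rw [measure_nonneg_toReal hT i' (hdiag i)]
        gcongr
        rw [← ENNReal.toReal_sum fun v _ => hfin _]
        exact ENNReal.toReal_mono (ENNReal.sum_ne_top.2 fun v _ => hfin _)
          (measure_biUnion_finset_le _ _)
    _ ≤ 1 / 2 + ∑ v ∈ nb, ε := by
        gcongr with v hv
        have hiv : s(i, v.1) ∈ E := (mem_filter.1 hv).2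
        exact measure_sameSide_le K i' v hT (hdiag i) (hdiag v) (hedge v.1 hiv) hε hδ
    _ ≤ 1 / 2 + Δ * ε := by
        rw [sum_const, nsmul_eq_mul]
        have : (nb.card : ℝ) ≤ Δ := by exact_mod_cast hnbcard
        nlinarith

/-- **The value of the solution**: `Σ_i x_i ≤ (1/2 + ∆ε)·n` under the hypotheses of `vcL_coord_le` at
every vertex. [cite: CharikarMakarychevMakarychev2009, Thm 5.4 proof (p. 12: "the value of the solution x is at most (1/2 + ε/6)|V|")] -/
theorem value_vcLocalSolution_le {d : ℕ} (hd : 1 ≤ d)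
    (hK : ∀ T : Finset (Fin n), T.card ≤ d → (localCov K (nbhd E T)).PosSemidef)
    (hdiag : ∀ u, K u u = 1) {δ ε : ℝ} (hε : 0 < ε) (hδ : δ ≤ ε ^ 3 / 16)
    (hedge : ∀ u v : Fin n, s(u, v) ∈ E → K u v ≤ -1 + δ) {Δ : ℕ}
    (hΔ : ∀ v : Fin n, (E.filter fun e => v ∈ e).card ≤ Δ) :
    (vcLocalSolution K E d hK).value ≤ (1 / 2 + Δ * ε) * n := by
  unfold VCLocalSolution.value VCLocalSolution.x
  calc ∑ i : Fin n, (vcLocalSolution K E d hK).L {i} (fun b => if b ⟨i, mem_singleton_self i⟩ then 1 else 0)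
      ≤ ∑ _i : Fin n, (1 / 2 + Δ * ε) := by
        refine sum_le_sum fun i _ => ?_
        rw [vcLocalSolution_L]
        exact vcL_coord_le E (hK {i} (by simpa using hd)) hdiag hε hδ (fun v hv => hedge i v hv) (hΔ i)
    _ = (1 / 2 + Δ * ε) * n := by rw [sum_const, card_univ, Fintype.card_fin, nsmul_eq_mul, mul_comm]

/-! ### Theorem 5.4 from local correlation matrices and from a gap graph -/

/-- **CMM Theorem 5.4 minus the graph theory.**  Let `E` be a loopless edge set on `[n]` of maximum
degree `∆`, `F` a symmetric target correlation with unit diagonal and `F(u,v) ≤ −1 + µ` on the edges,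
such that for every `T` with `|T| ≤ D` some positive semidefinite matrix on `T` is entrywise `η`-close
to `F|_T`, where `D ≥ (∆+1)d`, `D·η ≤ µ/2`, `40µ ≤ ε³`; then the level-`d` Vertex Cover relaxation on
`E` has a solution of value `≤ (1/2 + ∆ε)n` (the Gaussian sign rounding of the corrected kernel of
Thm 5.2 on the neighbourhoods `N(T)`, `|N(T)| ≤ (∆+1)|T| ≤ D`).
[cite: CharikarMakarychevMakarychev2009, Thm 5.4 proof (p. 12) with Thm 5.2 (p. 9–10) and Thm 3.1 (p. 6)] -/
theorem exists_vcLocalSolution_of_localCorrelations (E : Finset (Sym2 (Fin n)))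
    (hloop : ∀ e ∈ E, ¬ e.IsDiag) {Δ : ℕ} (hΔ : ∀ v : Fin n, (E.filter fun e => v ∈ e).card ≤ Δ)
    (F : Matrix (Fin n) (Fin n) ℝ) (hFsymm : ∀ u v, F u v = F v u) (hFdiag : ∀ u, F u u = 1)
    {μ η ε : ℝ} (hμ : 0 ≤ μ) (hη0 : 0 ≤ η) (hε : 0 < ε) (hμε : 40 * μ ≤ ε ^ 3)
    (hedge : ∀ u v : Fin n, s(u, v) ∈ E → F u v ≤ -1 + μ)
    {d D : ℕ} (hd : 1 ≤ d) (hdD : d * (Δ + 1) ≤ D) (hη : (D : ℝ) * η ≤ μ / 2)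
    (hloc : ∀ T : Finset (Fin n), T.card ≤ D →
      ∃ P : Matrix ↥T ↥T ℝ, P.PosSemidef ∧ ∀ i j : ↥T, |P i j - F i j| ≤ η) :
    ∃ Λ : VCLocalSolution n d E, Λ.value ≤ (1 / 2 + Δ * ε) * n := by
  set K := cmmKernel F μ with hKdef
  have hKD : ∀ S : Finset (Fin n), S.card ≤ D → (localCov K S).PosSemidef := by
    intro S hS
    obtain ⟨P, hP, hPF⟩ := hloc S hS
    refine posSemidef_localCov_cmmKernel hFsymm hμ hη0 S P hP hPF (le_trans ?_ hη)
    exact mul_le_mul_of_nonneg_right (by exact_mod_cast hS) hη0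
  have hK : ∀ T : Finset (Fin n), T.card ≤ d → (localCov K (nbhd E T)).PosSemidef := by
    intro T hT
    refine hKD _ ((card_nbhd_le E hΔ T).trans (le_trans ?_ hdD))
    exact Nat.mul_le_mul_right _ hT
  refine ⟨vcLocalSolution K E d hK, ?_⟩
  refine value_vcLocalSolution_le E hd hK (fun u => cmmKernel_diag hFdiag hμ u) hε
    (show 5 * μ / 2 ≤ ε ^ 3 / 16 by linarith) (fun u v huv => ?_) hΔ
  have hne : u ≠ v := fun h => hloop _ huv (by subst h; simp)
  exact cmmKernel_le_of_edge hμ hne (hedge u v huv)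

/-- **Theorem 5.4, pointwise form**: a loopless edge set with maximum degree `∆` whose sub-edge-sets on
`≤ √n` vertices are `l`-path decomposable carries a level-`d` Vertex Cover solution of value
`≤ (1/2 + ∆ε)n` as soon as the parameters fit: `0 ≤ µ ≤ 1`, `0 < ε`, `40µ ≤ ε³`, `(1−µ)^L ≤ 1/2`,
`9L ≤ l`, `1 ≤ d`, `(∆+1)d·(1−µ)^L ≤ µ/2`, `((∆+1)d(∆+1)^L)² ≤ n`.
[cite: CharikarMakarychevMakarychev2009, Thm 5.4 proof (p. 11–12) with Cor. 5.1 and Thm 2.4] -/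
theorem exists_vcLocalSolution_of_gapGraph (E : Finset (Sym2 (Fin n))) (hloop : ∀ e ∈ E, ¬ e.IsDiag)
    {Δ : ℕ} (hΔ : ∀ v : Fin n, (E.filter fun e => v ∈ e).card ≤ Δ) {l : ℕ}
    (hPD : ∀ E' ⊆ E, ((Multicut.supp E').card : ℝ) ^ 2 ≤ n → Multicut.PathDecomposable l E')
    {μ : ℝ} (hμ0 : 0 ≤ μ) (hμ1 : μ ≤ 1) {ε : ℝ} (hε : 0 < ε) (hμε : 40 * μ ≤ ε ^ 3) {L : ℕ}
    (hq : (1 - μ) ^ L ≤ 1 / 2) (hl : 9 * L ≤ l) {d : ℕ} (hd : 1 ≤ d)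
    (hη : ((d * (Δ + 1) : ℕ) : ℝ) * (1 - μ) ^ L ≤ μ / 2)
    (hfit : ((d * (Δ + 1) * (Δ + 1) ^ L : ℕ) : ℝ) ^ 2 ≤ n) :
    ∃ Λ : VCLocalSolution n d E, Λ.value ≤ (1 / 2 + Δ * ε) * n := by
  have hL : 1 ≤ L := Multicut.L_pos hq
  have h1μ : 0 ≤ 1 - μ := by linarith
  refine exists_vcLocalSolution_of_localCorrelations E hloop hΔ (cmmTarget E μ L) (cmmTarget_symm E μ L)
    (cmmTarget_diag E μ L) hμ0 (pow_nonneg h1μ L) hε hμε (fun u v huv => ?_) hd le_rfl hη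
    (cmm_hloc E hloop hΔ hμ0 hμ1 hq hl hPD hfit)
  have hne : u ≠ v := fun h => hloop _ huv (by subst h; simp)
  rw [cmmTarget_edge E μ hL huv hne]

end GaussianSignRounding

/-! ### Theorem 5.4: parameters and the limit `n → ∞` -/

section Assembly

open GaussianSignRounding Real Filter Topology

/-- **Charikar–Makarychev–Makarychev 2009, Theorem 5.4 (Sherali–Adams integrality gap `2 − ε` for VERTEX
COVER after `n^γ` rounds), PROVED.**  For every `ε > 0` there are `γ > 0` and `n₀` such that for all
`n ≥ n₀` there is a loopless nonempty graph `E` on `n` vertices in which every vertex cover has more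
than `(1 − ε)n` vertices, while the level-`⌊n^γ⌋` Sherali–Adams relaxation of Vertex Cover (local form,
`VCLocalSolution`; `⌊n^γ⌋ ≥ 2`) has a solution of value at most `(1/2 + ε)n`.
[cite: CharikarMakarychevMakarychev2009, Thm 5.4 (p. 11) and its proof (p. 11–12)] -/
theorem CharikarMakarychevMakarychev2009_thm54 :
    ∀ ε : ℝ, 0 < ε → ∃ γ : ℝ, 0 < γ ∧ ∃ n₀ : ℕ, ∀ n : ℕ, n₀ ≤ n →
      ∃ E : Finset (Sym2 (Fin n)), E.Nonempty ∧ (∀ e ∈ E, ¬ e.IsDiag) ∧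
        (∀ C : Finset (Fin n), IsVertexCoverOf E C → (1 - ε) * n < C.card) ∧
        2 ≤ ⌊(n : ℝ) ^ γ⌋₊ ∧
        ∃ Λ : VCLocalSolution n ⌊(n : ℝ) ^ γ⌋₊ E, Λ.value ≤ (1 / 2 + ε) * n := by
  intro ε hε
  -- the graphs
  obtain ⟨Δ, c, hc, n₀, hgraphs⟩ := RandomPairs.exists_vcGapGraphs ε hε
  -- parameters independent of `n`
  set ε₁ : ℝ := min ε 1 / (Δ + 1) with hε₁
  have hΔ1 : (0 : ℝ) < Δ + 1 := by positivity
  have hε₁0 : 0 < ε₁ := by rw [hε₁]; exact div_pos (lt_min hε one_pos) hΔ1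
  have hε₁1 : ε₁ ≤ 1 := by
    rw [hε₁, div_le_one hΔ1]
    have : (0 : ℝ) ≤ Δ := Nat.cast_nonneg _
    linarith [min_le_right ε 1]
  have hΔε₁ : (Δ : ℝ) * ε₁ ≤ ε := by
    rw [hε₁]
    have h1 : (Δ : ℝ) * (min ε 1 / (Δ + 1)) = min ε 1 * (Δ / (Δ + 1)) := by ring
    rw [h1]
    have h2 : (Δ : ℝ) / (Δ + 1) ≤ 1 := by rw [div_le_one hΔ1]; linarith
    calc min ε 1 * ((Δ : ℝ) / (Δ + 1)) ≤ min ε 1 * 1 :=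
          mul_le_mul_of_nonneg_left h2 (le_min hε.le zero_le_one)
      _ ≤ ε := by rw [mul_one]; exact min_le_left _ _
  set μ : ℝ := ε₁ ^ 3 / 40 with hμ
  have hμ0 : 0 < μ := by rw [hμ]; positivity
  have hμ1 : μ ≤ 1 := by
    rw [hμ]; have : ε₁ ^ 3 ≤ 1 ^ 3 := pow_le_pow_left₀ hε₁0.le hε₁1 3
    linarith
  have hμε : 40 * μ ≤ ε₁ ^ 3 := by rw [hμ]; linarith
  set c' : ℝ := min c (1 / (4 * Real.log (Δ + 2))) with hc'
  have hlog2 : 0 < Real.log ((Δ : ℝ) + 2) :=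
    Real.log_pos (by have := Nat.cast_nonneg (α := ℝ) Δ; linarith)
  have hc'0 : 0 < c' := lt_min hc (by positivity)
  have hc'c : c' ≤ c := min_le_left _ _
  have hcΔ : c' * Real.log (Δ + 2) ≤ 1 / 4 := by
    have h1 : c' ≤ 1 / (4 * Real.log (Δ + 2)) := min_le_right _ _
    calc c' * Real.log (Δ + 2) ≤ 1 / (4 * Real.log (Δ + 2)) * Real.log (Δ + 2) :=
          mul_le_mul_of_nonneg_right h1 hlog2.le
      _ = 1 / 4 := by field_simp
  set γ : ℝ := μ * c' / 18 with hγ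
  have hγ0 : 0 < γ := by rw [hγ]; positivity
  have hγ18 : γ ≤ 1 / 18 := by
    rw [hγ]
    have hc'1 : c' ≤ 1 := by
      have : c' * Real.log (Δ + 2) ≥ c' * Real.log 2 :=
        mul_le_mul_of_nonneg_left (Real.log_le_log (by norm_num)
          (by have := Nat.cast_nonneg (α := ℝ) Δ; linarith)) hc'0.le
      have hl2 : Real.log 2 > 1 / 2 := by have := Real.log_two_gt_d9; linarith
      nlinarith
    nlinarith
  refine ⟨γ, hγ0, ?_⟩
  -- the conditions that hold for large `n`
  have ev1 : ∀ᶠ k : ℕ in atTop, n₀ ≤ k := eventually_ge_atTop n₀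
  have ev0 : ∀ᶠ k : ℕ in atTop, 1 ≤ k := eventually_ge_atTop 1
  have hpow : Tendsto (fun k : ℕ => (k : ℝ) ^ γ) atTop atTop :=
    (tendsto_rpow_atTop hγ0).comp tendsto_natCast_atTop_atTop
  have ev2 : ∀ᶠ k : ℕ in atTop, (2 : ℝ) ≤ (k : ℝ) ^ γ := hpow.eventually_ge_atTop 2
  have hdecay : Tendsto (fun k : ℕ => ((Δ : ℝ) + 1) * Real.exp μ * (k : ℝ) ^ (-γ)) atTop
      (𝓝 (((Δ : ℝ) + 1) * Real.exp μ * 0)) :=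
    ((tendsto_rpow_neg_atTop hγ0).comp tendsto_natCast_atTop_atTop).const_mul _
  rw [mul_zero] at hdecay
  have ev3 : ∀ᶠ k : ℕ in atTop, ((Δ : ℝ) + 1) * Real.exp μ * (k : ℝ) ^ (-γ) < μ / 2 :=
    hdecay.eventually (gt_mem_nhds (by positivity))
  have hpow56 : Tendsto (fun k : ℕ => (k : ℝ) ^ (5 / 6 : ℝ)) atTop atTop :=
    (tendsto_rpow_atTop (by norm_num)).comp tendsto_natCast_atTop_atTop
  have ev4 : ∀ᶠ k : ℕ in atTop, ((Δ : ℝ) + 1) ^ 2 ≤ (k : ℝ) ^ (5 / 6 : ℝ) :=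
    hpow56.eventually_ge_atTop _
  obtain ⟨n₁, hn₁⟩ := eventually_atTop.1 (ev1.and (ev0.and (ev2.and (ev3.and ev4))))
  refine ⟨n₁, fun n hn => ?_⟩
  obtain ⟨h₀, h1, h2, h3, h4⟩ := hn₁ n hn
  obtain ⟨E, hE, hloop, hΔ, -, hVC, hPD⟩ := hgraphs n h₀
  have hn' : (0 : ℝ) < n := by exact_mod_cast h1
  -- the `n`-dependent parameters
  set L : ℕ := ⌊c' * Real.log n⌋₊ / 9 with hLdef
  set d : ℕ := ⌊(n : ℝ) ^ γ⌋₊ with hddef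
  have hdle : (d : ℝ) ≤ (n : ℝ) ^ γ := Nat.floor_le (by positivity)
  have hd2 : 2 ≤ d := by rw [hddef]; exact Nat.le_floor (by exact_mod_cast h2)
  have h1μ : 0 ≤ 1 - μ := by linarith
  -- `η = (1−µ)^L ≤ e^µ n^{−2γ}` and `(∆+1) d η ≤ µ/2`
  have hηle : (1 - μ) ^ L ≤ Real.exp μ * (n : ℝ) ^ (-(μ * c' / 9)) :=
    one_sub_pow_L_le hμ0.le hμ1 h1
  have h2γ : -(μ * c' / 9) = -γ + -γ := by rw [hγ]; ring
  have hdη : ((d * (Δ + 1) : ℕ) : ℝ) * (1 - μ) ^ L ≤ μ / 2 := by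
    push_cast
    calc (d : ℝ) * (Δ + 1) * (1 - μ) ^ L
        ≤ (n : ℝ) ^ γ * (Δ + 1) * (Real.exp μ * (n : ℝ) ^ (-(μ * c' / 9))) :=
          mul_le_mul (mul_le_mul_of_nonneg_right hdle hΔ1.le) hηle (pow_nonneg h1μ L) (by positivity)
      _ = ((Δ : ℝ) + 1) * Real.exp μ * (n : ℝ) ^ (-γ) := by
          rw [h2γ, Real.rpow_add hn', Real.rpow_neg hn'.le]
          have : (n : ℝ) ^ γ ≠ 0 := (Real.rpow_pos_of_pos hn' γ).ne'
          field_simp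
      _ ≤ μ / 2 := h3.le
  have hq : (1 - μ) ^ L ≤ 1 / 2 := by
    have : (1 - μ) ^ L ≤ ((d * (Δ + 1) : ℕ) : ℝ) * (1 - μ) ^ L := by
      have hd1 : (1 : ℝ) ≤ ((d * (Δ + 1) : ℕ) : ℝ) := by
        exact_mod_cast (Nat.mul_pos (by omega : 0 < d) (Nat.succ_pos Δ))
      nlinarith [pow_nonneg h1μ L]
    linarith
  -- the ball fits: `((∆+1) d (∆+1)^L)² ≤ n`
  have hfit : ((d * (Δ + 1) * (Δ + 1) ^ L : ℕ) : ℝ) ^ 2 ≤ n := by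
    have hb : ((Δ + 1 : ℕ) : ℝ) ^ L ≤ (n : ℝ) ^ (1 / 36 : ℝ) := pow_L_le hc'0.le hcΔ h1
    have hprod : ((d * (Δ + 1) * (Δ + 1) ^ L : ℕ) : ℝ) ≤ ((Δ : ℝ) + 1) * (n : ℝ) ^ (γ + 1 / 36) := by
      push_cast
      rw [Real.rpow_add hn']
      have e : (d : ℝ) * ((Δ : ℝ) + 1) * ((Δ : ℝ) + 1) ^ L = ((Δ : ℝ) + 1) * ((d : ℝ) * ((Δ : ℝ) + 1) ^ L) := by
        ring
      rw [e]
      refine mul_le_mul_of_nonneg_left ?_ hΔ1.le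
      exact mul_le_mul hdle (by exact_mod_cast hb) (by positivity) (by positivity)
    have hexp : 2 * (γ + 1 / 36) ≤ 1 / 6 := by linarith
    calc ((d * (Δ + 1) * (Δ + 1) ^ L : ℕ) : ℝ) ^ 2 ≤ (((Δ : ℝ) + 1) * (n : ℝ) ^ (γ + 1 / 36)) ^ 2 :=
          pow_le_pow_left₀ (Nat.cast_nonneg _) hprod 2
      _ = ((Δ : ℝ) + 1) ^ 2 * (n : ℝ) ^ (2 * (γ + 1 / 36)) := by
          rw [mul_pow, ← Real.rpow_natCast ((n : ℝ) ^ (γ + 1 / 36)), ← Real.rpow_mul hn'.le]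
          ring_nf
      _ ≤ (n : ℝ) ^ (5 / 6 : ℝ) * (n : ℝ) ^ (1 / 6 : ℝ) := by
          refine mul_le_mul h4 (Real.rpow_le_rpow_of_exponent_le (by exact_mod_cast h1) hexp)
            (by positivity) (by positivity)
      _ = n := by rw [← Real.rpow_add hn']; norm_num
  -- path decomposability at length `9L ≤ ⌊c log n⌋`
  have hl : 9 * L ≤ ⌊c * Real.log n⌋₊ := by
    have h9 : 9 * L ≤ ⌊c' * Real.log n⌋₊ := by rw [hLdef]; exact Nat.mul_div_le _ 9
    refine h9.trans (Nat.floor_le_floor ?_)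
    exact mul_le_mul_of_nonneg_right hc'c (Real.log_nonneg (by exact_mod_cast h1))
  obtain ⟨Λ, hΛ⟩ := exists_vcLocalSolution_of_gapGraph E hloop hΔ hPD hμ0.le hμ1 hε₁0 hμε hq hl
    (by omega) hdη hfit
  refine ⟨E, hE, hloop, fun C hC => card_vertexCover_gt hVC hC, hd2, Λ, hΛ.trans ?_⟩
  exact mul_le_mul_of_nonneg_right (by linarith) hn'.le

/-- **Theorem 5.4 in the printed ratio form: the integrality gap of the `n^γ`-round Sherali–Adams
relaxation of Vertex Cover is at least `2 − ε`**: every vertex cover is at least `(2 − ε)` times the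
value of the Sherali–Adams solution. [cite: CharikarMakarychevMakarychev2009, Thm 5.4 (p. 11: "the integrality gap of the relaxation for Vertex Cover is 2 − ε after r = n^γ rounds")] -/
theorem CharikarMakarychevMakarychev2009_thm54_gap :
    ∀ ε : ℝ, 0 < ε → ∃ γ : ℝ, 0 < γ ∧ ∃ n₀ : ℕ, ∀ n : ℕ, n₀ ≤ n →
      ∃ (E : Finset (Sym2 (Fin n))) (Λ : VCLocalSolution n ⌊(n : ℝ) ^ γ⌋₊ E),
        E.Nonempty ∧ (∀ e ∈ E, ¬ e.IsDiag) ∧ 2 ≤ ⌊(n : ℝ) ^ γ⌋₊ ∧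
        ∀ C : Finset (Fin n), IsVertexCoverOf E C → (2 - ε) * Λ.value ≤ C.card := by
  intro ε hε
  obtain ⟨γ, hγ, n₀, h⟩ := CharikarMakarychevMakarychev2009_thm54 (ε / 6) (by positivity)
  refine ⟨γ, hγ, n₀, fun n hn => ?_⟩
  obtain ⟨E, hE, hloop, hVC, hd2, Λ, hΛ⟩ := h n hn
  refine ⟨E, Λ, hE, hloop, hd2, fun C hC => ?_⟩
  have h1 := hVC C hC
  have hn0 : (0 : ℝ) ≤ n := Nat.cast_nonneg _
  have hval0 : 0 ≤ Λ.value := Λ.value_nonneg (by omega)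
  by_cases hε2 : ε ≤ 2
  · -- `(2 − ε)·value ≤ (2 − ε)(1/2 + ε/6) n ≤ (1 − ε/6) n < |C|`
    have h2 : (2 - ε) * Λ.value ≤ (2 - ε) * ((1 / 2 + ε / 6) * n) :=
      mul_le_mul_of_nonneg_left hΛ (by linarith)
    have h3 : (2 - ε) * ((1 / 2 + ε / 6) * n) = (1 - ε / 6) * n - ε ^ 2 / 6 * n := by ring
    have h4 : 0 ≤ ε ^ 2 / 6 * n := by positivity
    linarith
  · push Not at hε2
    have : (2 - ε) * Λ.value ≤ 0 := mul_nonpos_of_nonpos_of_nonneg (by linarith) hval0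
    linarith [(Nat.cast_nonneg C.card : (0 : ℝ) ≤ C.card)]

end Assembly

end Literature.Combinatorics.Optimization

end
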